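import Summits.BirchSwinnertonDyer.Rank1Residual.X11b.FrameLambdaUnit
import Summits.BirchSwinnertonDyer.Rank1Residual.X11b.AnticyclotomicSelmerDual
import HarnessLib

/-!
# Route `CumulativeHeegnerLeopoldt`, crux K1 `CumulativeHeegnerInclusionAtThree` (stmt-BirchSwinnertonDyer-24198),
# line `birth` v3, STUB A `stub_temperedInclusion`: the tempered inclusion and K1's conclusion DO NOT SEE THE
# FRAME — ∀-frame ⟸ one frame per `(κ, γ, 𝔭, 𝔭′, ι′)`. HELPER (`--supports 24198`), lead prover bsd-line-chl-k1-p1 g0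

K1 and stub A are typed with the `R₀`-frame `(Ω_K, Ω_p, L)` UNIVERSALLY quantified
(`∀ ΩK Ωp L, ΩK ≠ 0 → Ωp ≠ 0 → IsBDPLFunction ι′ 𝔭 κ γ f ΩK Ωp L → …`). By the tree's frame rigidity
(`X11b.R1.exists_iwasawaUnit_mul_eq_of_isBDPLFunction`, odd `p`, `K` imaginary quadratic, `κ` anticyclotomic:
two frames of the same `(ι′, 𝔭, κ, γ, f)` with non-zero periods satisfy `L′ = (map U)·L`, `U ∈ Λˣ`) the two
conclusions of line `birth` that mention `L` —

* stub A's `∃ μ, span{3^μ·L} ≤ I` (`I = Ch_Λ(X_{∅,0})·R₀⟦T⟧`), and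
* K1's `span{L} ≤ I` —

are frame-independent (§1: `span_pow_mul_eq_of_isBDPLFunction`, `temperedInclusion_iff_of_frames`,
`inclusion_iff_of_frames`, for ANY ideal `I` of `R₀⟦T⟧`), so a proof of stub A (resp. of K1) for ONE frame per datum
`(W, K, κ, γ, 𝔭, 𝔭′, ι′)` is a proof for all (§2: `temperedInclusion_forall_frames_of_one`, `inclusion_forall_frames_of_one`,
stated on the route's object `XAc.charIdeal (W.baseChange K) 3 κ 𝔭′ ∅ γ`). This answers the v2 card's «disprover-wanted: the
∀-frame typing» for K1: the ∀ over frames carries no extra content beyond the ∃-frame of K3 `WildSplitFrameAtThree`.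
No definition, no named fact, no `sorry`; nothing is asserted about stub A itself; BSD is not proved by any of this.

References: [Castella2018] Thm. 3.1 (arXiv:1704.06608 p. 9) (the frame); [Washington1997] §7.1 (units of `Λ`).
-/

set_option autoImplicit false
set_option linter.dupNamespace false -- `Summit.BirchSwinnertonDyer.BirchSwinnertonDyer.Theorems.…` (summit = sub)

noncomputable section

open scoped Classical

namespace Summit.BirchSwinnertonDyer.BirchSwinnertonDyer.Theorems.CumulativeHeegnerInclusionAtThreeFrameBlind

open PowerSeries NumberField IsDedekindDomain Field
  Literature.NumberTheory.EllipticCurves Literature.NumberTheory.GaloisRepresentations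
  Summit.BirchSwinnertonDyer.Rank1Residual.X11b Summit.BirchSwinnertonDyer.Rank1Residual.X11b.Halves

variable {K : Type} [Field K] [NumberField K] {N : ℕ} {ι' : PadicAlgCl 3 ≃+* ℂ}
  {𝔭 : HeightOneSpectrum (𝓞 K)} {κ : ZpExtension K 3} {γ : Field.absoluteGaloisGroup K}
  {f : CuspForm (CongruenceSubgroup.Gamma0 N) 2} {ΩK ΩK' : ℂ} {Ωp Ωp' : ℂ_[3]} {L L' : UnrSeries 3}

/-! ### §1 Frame-blindness of the two `L`-shapes of line `birth` (any ideal `I`) -/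

/-- **Two `R₀`-frames give the same tempered ideals**: `span{3^μ·L′} = span{3^μ·L}` for every `μ`, since
`L′ = (map U)·L` with `U ∈ Λˣ` (`R1.exists_iwasawaUnit_mul_eq_of_isBDPLFunction`; `p = 3` odd, `K` imaginary
quadratic, `κ` anticyclotomic, `γ` a topological generator, non-zero periods). [cite: Castella2018, Thm. 3.1 (arXiv:1704.06608 p. 9)] -/
theorem span_pow_mul_eq_of_isBDPLFunction (hK : IsImaginaryQuadratic K) (hκ : κ.IsAnticyclotomic)
    (hγ : κ.IsTopGenerator γ) (hΩK : ΩK ≠ 0) (hΩK' : ΩK' ≠ 0) (hΩp : Ωp ≠ 0) (hΩp' : Ωp' ≠ 0)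
    (hL : IsBDPLFunction ι' 𝔭 κ γ f ΩK Ωp L) (hL' : IsBDPLFunction ι' 𝔭 κ γ f ΩK' Ωp' L') (μ : ℕ) :
    Ideal.span ({(3 : UnrSeries 3) ^ μ * L'} : Set (UnrSeries 3)) = Ideal.span {(3 : UnrSeries 3) ^ μ * L} := by
  obtain ⟨U, hU, h⟩ :=
    R1.exists_iwasawaUnit_mul_eq_of_isBDPLFunction (p := 3) (by decide) hK hκ hγ hΩK hΩK' hΩp hΩp' hL hL'
  rw [h, mul_left_comm]
  exact Ideal.span_singleton_mul_left_unit (hU.map _) _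

/-- **Stub A's conclusion does not see the frame**: for any ideal `I ≤ R₀⟦T⟧`,
`(∃ μ, span{3^μ·L} ≤ I) ↔ (∃ μ, span{3^μ·L′} ≤ I)`. [cite: Castella2018, Thm. 3.1 (arXiv:1704.06608 p. 9)] -/
theorem temperedInclusion_iff_of_frames (hK : IsImaginaryQuadratic K) (hκ : κ.IsAnticyclotomic)
    (hγ : κ.IsTopGenerator γ) (hΩK : ΩK ≠ 0) (hΩK' : ΩK' ≠ 0) (hΩp : Ωp ≠ 0) (hΩp' : Ωp' ≠ 0)
    (hL : IsBDPLFunction ι' 𝔭 κ γ f ΩK Ωp L) (hL' : IsBDPLFunction ι' 𝔭 κ γ f ΩK' Ωp' L')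
    (I : Ideal (UnrSeries 3)) :
    (∃ μ : ℕ, Ideal.span {(3 : UnrSeries 3) ^ μ * L} ≤ I) ↔
      ∃ μ : ℕ, Ideal.span {(3 : UnrSeries 3) ^ μ * L'} ≤ I := by
  simp only [span_pow_mul_eq_of_isBDPLFunction hK hκ hγ hΩK hΩK' hΩp hΩp' hL hL']

/-- **K1's conclusion does not see the frame**: for any ideal `I ≤ R₀⟦T⟧`, `span{L} ≤ I ↔ span{L′} ≤ I`
(`R1.span_singleton_eq_of_isBDPLFunction`). [cite: Castella2018, Thm. 3.1 (arXiv:1704.06608 p. 9)] -/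
theorem inclusion_iff_of_frames (hK : IsImaginaryQuadratic K) (hκ : κ.IsAnticyclotomic)
    (hγ : κ.IsTopGenerator γ) (hΩK : ΩK ≠ 0) (hΩK' : ΩK' ≠ 0) (hΩp : Ωp ≠ 0) (hΩp' : Ωp' ≠ 0)
    (hL : IsBDPLFunction ι' 𝔭 κ γ f ΩK Ωp L) (hL' : IsBDPLFunction ι' 𝔭 κ γ f ΩK' Ωp' L')
    (I : Ideal (UnrSeries 3)) :
    Ideal.span {L} ≤ I ↔ Ideal.span {L'} ≤ I := by
  rw [R1.span_singleton_eq_of_isBDPLFunction (p := 3) (by decide) hK hκ hγ hΩK hΩK' hΩp hΩp' hL hL']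

/-! ### §2 ∀-frame ⟸ one frame, on the route's object -/

variable (W : WeierstrassCurve ℚ) (𝔭' : HeightOneSpectrum (𝓞 K)) [Fact (κ.IsTopGenerator γ)]

/-- **Stub A for all frames from stub A for one frame.** If SOME `R₀`-frame `(Ω_K⁰ ≠ 0, Ω_p⁰ ≠ 0, L⁰)` of
`(ι′, 𝔭, κ, γ, f)` has `span{3^μ·L⁰} ≤ Ch_Λ(X_{∅,0}(𝔭′))·R₀⟦T⟧` for some `μ`, then EVERY frame with non-zero periods
does (for some `μ`). [cite: Castella2018, Thm. 3.1 (arXiv:1704.06608 p. 9)] -/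
theorem temperedInclusion_forall_frames_of_one (hK : IsImaginaryQuadratic K) (hκ : κ.IsAnticyclotomic)
    {ΩK₀ : ℂ} {Ωp₀ : ℂ_[3]} {L₀ : UnrSeries 3} (hΩK₀ : ΩK₀ ≠ 0) (hΩp₀ : Ωp₀ ≠ 0)
    (hL₀ : IsBDPLFunction ι' 𝔭 κ γ f ΩK₀ Ωp₀ L₀)
    (h₀ : ∃ μ : ℕ, Ideal.span {(3 : UnrSeries 3) ^ μ * L₀} ≤
      (AcSelmer.XAc.charIdeal (W.baseChange K) 3 κ 𝔭' ∅ γ).map (PowerSeries.map (toUnr 3))) :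
    ∀ (ΩK : ℂ) (Ωp : ℂ_[3]) (L : UnrSeries 3), ΩK ≠ 0 → Ωp ≠ 0 → IsBDPLFunction ι' 𝔭 κ γ f ΩK Ωp L →
      ∃ μ : ℕ, Ideal.span {(3 : UnrSeries 3) ^ μ * L} ≤
        (AcSelmer.XAc.charIdeal (W.baseChange K) 3 κ 𝔭' ∅ γ).map (PowerSeries.map (toUnr 3)) :=
  fun _ΩK _Ωp _L hΩK hΩp hL ↦
    (temperedInclusion_iff_of_frames hK hκ (Fact.out : κ.IsTopGenerator γ) hΩK₀ hΩK hΩp₀ hΩp hL₀ hL _).mp h₀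

/-- **K1's conclusion for all frames from one frame.** If SOME `R₀`-frame of `(ι′, 𝔭, κ, γ, f)` with non-zero
periods has `span{L⁰} ≤ Ch_Λ(X_{∅,0}(𝔭′))·R₀⟦T⟧`, then EVERY frame with non-zero periods does.
[cite: Castella2018, Thm. 3.1 (arXiv:1704.06608 p. 9)] -/
theorem inclusion_forall_frames_of_one (hK : IsImaginaryQuadratic K) (hκ : κ.IsAnticyclotomic)
    {ΩK₀ : ℂ} {Ωp₀ : ℂ_[3]} {L₀ : UnrSeries 3} (hΩK₀ : ΩK₀ ≠ 0) (hΩp₀ : Ωp₀ ≠ 0)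
    (hL₀ : IsBDPLFunction ι' 𝔭 κ γ f ΩK₀ Ωp₀ L₀)
    (h₀ : Ideal.span {L₀} ≤
      (AcSelmer.XAc.charIdeal (W.baseChange K) 3 κ 𝔭' ∅ γ).map (PowerSeries.map (toUnr 3))) :
    ∀ (ΩK : ℂ) (Ωp : ℂ_[3]) (L : UnrSeries 3), ΩK ≠ 0 → Ωp ≠ 0 → IsBDPLFunction ι' 𝔭 κ γ f ΩK Ωp L →
      Ideal.span {L} ≤ (AcSelmer.XAc.charIdeal (W.baseChange K) 3 κ 𝔭' ∅ γ).map (PowerSeries.map (toUnr 3)) :=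
  fun _ΩK _Ωp _L hΩK hΩp hL ↦
    (inclusion_iff_of_frames hK hκ (Fact.out : κ.IsTopGenerator γ) hΩK₀ hΩK hΩp₀ hΩp hL₀ hL _).mp h₀

end Summit.BirchSwinnertonDyer.BirchSwinnertonDyer.Theorems.CumulativeHeegnerInclusionAtThreeFrameBlind

end
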